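import Summits.ABC.IUTFork.Joshi.LogLinkInsertedIsometry
import Summits.ABC.IUTFork.Joshi.TestThetaValuesLocusModel
import Mathlib.Algebra.MvPolynomial.Variables
import HarnessLib

/-!
# A kernel MODEL in which §10.13's Frobenius transport `T` and the Witt–Teichmüller law `ϕ([a]) = [a^p]` (`hφ`) hold TOGETHER
# over the [J-IIp] period-ring signature — non-vacuity of the binder pair of `Joshi/LogLinkInsertedIsometry.lean` (p437232), nothing more

Test-side support file of the abc-iut cell, branch E «type Joshi's construction, test vs S» (rung LADDER-ABC:A2.E; seat abc-iut-E-t52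
gen 3, the base's WAKE row). Hypotheses instantiated: E-t7's `PeriodRingDatum.FrobeniusTransport` (p430819, §10.13 «`ϕ(𝔪_{y_{n−1}}) = 𝔪_{y_n}`»)
and `hφ : ∀ a, ϕ [a] = [a^p]` (p437232, print p.33 l.7), whose JOINT satisfiability over E-t3's signature `PeriodRingDatum`
(`Joshi/ThetaValuesLocus.lean`, p427971) p437232 records as «NOT exhibited by the cell's models» (in a pull-back model `B = (Y → Q̄_p)`,
`ϕ b = b ∘ σ`, `hφ` reads `L_{σ s}(x) = L_s(x^p)` pointwise, so with (A1) it forbids `σ`-periodic points — which p432971 (`ϕ = id`) and the column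
models p434703 / p439129 (`σ = id` off the column) have; this file leaves function rings instead).
Source of the hypotheses: K. Joshi, arXiv:2303.01662v3 §10 (bib `Joshi2023ATS2Local`, unrefereed — TYPED AS A CANDIDATE by E-t3/E-t7).
TAKES NO SIDE on [IUTchIII] Cor. 3.12, on Joshi's claims, or on Mochizuki's reports on them; a model EXHIBITS satisfiability of TYPED
hypotheses, nothing more; typed ≠ proved ≠ endorsed.

THE MODEL `datum p` (all carriers over `Q̄_p = PadicAlgCl p`, E-t3's `lift`/`expo`/`absPow` consumed BY NAME). The period ring is NOT a function
ring: `B := MvPolynomial Q̄_p (ℤ → Q̄_p)` — one variable `X_a` per `a ∈ F := Q̄_p`, the FORMAL Teichmüller `[a] := X_a`, coefficients = functions on a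
`ℤ`-indexed column. `ϕ := rename (a ↦ a^p) ∘ map (shift)` is a RING ENDOMORPHISM with `ϕ(X_a) = X_{a^p}`: `hφ` holds BY CONSTRUCTION
(`frob_teich`). Norm `|f|_ρ := max ‖a‖` over the variables occurring in `f` (ultrametric, `|X_a| = ‖a‖`, `B⁺` is `ϕ`-stable since `‖a^p‖ ≤ 1`
when `‖a‖ ≤ 1`). Points `Y := Q̄_p ⊕ ℕ`: a generic point `a` carries E-t3's `K_a = (Q̄_p, ‖·‖^{e_a})` and `η_a := eval₂ ev₀ lift_a` (so (A1)–(A4)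
are E-t3's lemmas); the column point `n` carries `K_n = (Q̄_p, ‖·‖^{1/p^n})`, `η_n := eval₂ ev_n (x ↦ x^{p^n})`, and `ϕ(n+1) = n` on points.
KEY IDENTITY `eta_comp_frob`: `η_n ∘ ϕ = η_{n+1}` as ring maps (`(x^p)^{p^n} = x^{p^{n+1}}`, `ev_n ∘ shift = ev_{n+1}`) ⇒ equal kernels ⇒
**`transport n : FrobeniusTransport (n+1)` at EVERY column point** (both `η` onto via constants). Also: `T_y := {0}` (so `KummerShift` holds
trivially — a non-degenerate `T` is p434703's business, not this file's); `B^{φ=p} ∋ C(m ↦ p^{m−n}) ≠ 0` with `η_n` of it `= 1` («log hits 1»,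
`hone`); the identity identifications `K_{n+1} = K_n = Q̄_p` are `FrobCompatible` (`σ_y = id` on elements). CONSEQUENCES IN THE MODEL, by the
landed implications cited BY NAME: `scale (ϕ y) = p · scale y` and `|σ_y ξ| = |ξ|^p` (p437232 §1), `¬NoCommutingFieldIso`, `¬NoInsertedIso`,
`LogShellStep`, `¬LogsCoincide` (p430819) — the (R-ϕ) horn of Thm. 10.15.1 (3)/(4) realised TOGETHER WITH `hφ` in one structure; and p437232 §3's
binders `h₀`, `h₁` («identifications compatible with the valuations up to exponents», here `s₀ = p^{n+1}`, `s₁ = p^n` for `|·|_C = ‖·‖`) hold too,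
its conclusion giving an isometric inserted automorphism (`exists_isometric_insertedIso`).
What is NOT here: `char F = p` (as in every model of the cell, `F = Q̄_p`); a non-trivial Tate module; any claim about Joshi's or
Mochizuki's mathematics. [folklore] model-building.
-/

noncomputable section

open MvPolynomial

namespace Summit.ABC.IUTFork.Joshi.TeichFrobModel

open Summit.ABC.IUTFork.Joshi.Model

variable (p : ℕ) [hp : Fact p.Prime]

/-- Local copy: `0 < ‖p‖ < 1` in `Q̄_p`. [folklore] -/
private theorem norm_p_pos_lt_one : 0 < ‖(p : PadicAlgCl p)‖ ∧ ‖(p : PadicAlgCl p)‖ < 1 := by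
  have h : ‖(p : PadicAlgCl p)‖ = (p : ℝ)⁻¹ := by
    rw [← map_natCast (algebraMap ℚ_[p] (PadicAlgCl p)), ← PadicAlgCl.coe_eq]
    show ‖((p : ℚ_[p]) : PadicAlgCl p)‖ = _
    rw [PadicAlgCl.norm_extends, Padic.norm_p]
  have h1 : (1 : ℝ) < p := by exact_mod_cast hp.out.one_lt
  rw [h]
  exact ⟨inv_pos.2 (lt_trans one_pos h1), inv_lt_one_of_one_lt₀ h1⟩

/-! ## 1. The period ring `B = Q̄_p-polynomials in formal Teichmüllers, with column coefficients`, its Frobenius and norm -/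

/-- Coefficients: functions on a `ℤ`-indexed column. [folklore] -/
abbrev Coef : Type := ℤ → PadicAlgCl p

/-- The model period ring `B := MvPolynomial Q̄_p (ℤ → Q̄_p)` (variable `X_a` = formal Teichmüller `[a]`). [folklore] -/
abbrev Ring : Type := MvPolynomial (PadicAlgCl p) (Coef p)

/-- The model points `Y := Q̄_p ⊕ ℕ` (generic points `a`, column points `n`). [folklore] -/
abbrev Pt : Type := PadicAlgCl p ⊕ ℕ

/-- The coefficient shift `(shift c)(m) = c(m+1)`, a ring endomorphism. [folklore] -/
def shiftHom : Coef p →+* Coef p where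
  toFun c m := c (m + 1)
  map_one' := rfl
  map_mul' _ _ := rfl
  map_zero' := rfl
  map_add' _ _ := rfl

/-- `(shift c)(m) = c(m+1)`. [folklore] -/
@[simp] theorem shiftHom_apply (c : Coef p) (m : ℤ) : shiftHom p c m = c (m + 1) := rfl

/-- **The Frobenius `ϕ` of the model**: `X_a ↦ X_{a^p}` on variables, shift on coefficients — a ring endomorphism of `B`. [folklore] -/
def frobHom : Ring p →+* Ring p :=
  (rename fun a : PadicAlgCl p => a ^ p).toRingHom.comp (MvPolynomial.map (shiftHom p))

/-- `ϕ(X_a) = X_{a^p}` — the Witt–Teichmüller law `ϕ([a]) = [a^p]`, by construction. [folklore] -/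
theorem frobHom_X (a : PadicAlgCl p) : frobHom p (X a) = X (a ^ p) := by simp [frobHom, map_X, rename_X]

/-- `ϕ(C c) = C (shift c)`. [folklore] -/
theorem frobHom_C (c : Coef p) : frobHom p (C c) = C (shiftHom p c) := by simp [frobHom, map_C]

/-- The model norm `|f| := max ‖a‖` over the variables `X_a` occurring in `f` (`0` if none). [folklore] -/
def vnorm (f : Ring p) : ℝ := ((f.vars.sup fun a => ‖a‖₊ : NNReal) : ℝ)

/-- `|f| ≥ 0`. [folklore] -/
theorem vnorm_nonneg (f : Ring p) : 0 ≤ vnorm p f := NNReal.coe_nonneg _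

/-- Ultrametricity: `|f + g| ≤ max(|f|, |g|)` (`vars (f+g) ⊆ vars f ∪ vars g`). [folklore] -/
theorem vnorm_add (f g : Ring p) : vnorm p (f + g) ≤ max (vnorm p f) (vnorm p g) := by
  classical
  simp only [vnorm, ← NNReal.coe_max, NNReal.coe_le_coe]
  exact (Finset.sup_mono (vars_add_subset f g)).trans (le_of_eq Finset.sup_union)

/-- `|X_a| = ‖a‖` (axiom `|[x]|_ρ = |x|_F`). [folklore] -/
theorem vnorm_X (a : PadicAlgCl p) : vnorm p (X a) = ‖a‖ := by simp [vnorm, vars_X]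

/-- `|0| ≤ 1`. [folklore] -/
theorem vnorm_zero_le : vnorm p 0 ≤ 1 := by simp [vnorm, vars_0]

/-- `B⁺ = {|f| ≤ 1}` is `ϕ`-stable: the variables of `ϕ f` are `p`-th powers of variables of `f`. [folklore] -/
theorem vnorm_frob_le_one {f : Ring p} (h : vnorm p f ≤ 1) : vnorm p (frobHom p f) ≤ 1 := by
  classical
  simp only [vnorm, ← NNReal.coe_one, NNReal.coe_le_coe] at h ⊢
  refine Finset.sup_le fun b hb => ?_
  obtain ⟨a, ha, rfl⟩ := Finset.mem_image.1 (vars_rename _ _ hb)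
  have ha' : ‖a‖₊ ≤ 1 := (Finset.le_sup (f := fun a => ‖a‖₊) (vars_map _ _ ha)).trans h
  rw [nnnorm_pow]
  exact pow_le_one₀ (by simp) ha'

/-! ## 2. Points, residue fields, untilt maps -/

/-- The valuation exponent: E-t3's `e_a` at a generic point, `1/p^n` at the column point `n`. [folklore] -/
def ex : Pt p → ℝ
  | Sum.inl a => expo p a
  | Sum.inr n => ((p ^ n : ℕ) : ℝ)⁻¹

/-- Exponents are positive. [folklore] -/
theorem ex_pos : ∀ y : Pt p, 0 < ex p y
  | Sum.inl a => expo_pos p a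
  | Sum.inr n => inv_pos.2 (by exact_mod_cast pow_pos hp.out.pos n)

/-- The untilt map on formal Teichmüllers: E-t3's `lift_a` at a generic point, `x ↦ x^{p^n}` at the column point `n`. [folklore] -/
def untilt : Pt p → PadicAlgCl p → PadicAlgCl p
  | Sum.inl a => lift p a
  | Sum.inr n => fun x => x ^ p ^ n

/-- The coefficient index read at a point (`0` at generic points, `n` at the column point `n`). [folklore] -/
def idx : Pt p → ℤ
  | Sum.inl _ => 0
  | Sum.inr n => n

/-- **`η_{K_y} : B → K_y`**: evaluate coefficients at `idx y` and `X_a` at `untilt y a`. [folklore] -/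
def etaHom (y : Pt p) : Ring p →+* PadicAlgCl p := eval₂Hom (Pi.evalRingHom _ (idx p y)) (untilt p y)

/-- The Frobenius on points: `a ↦ a^p` on generic points (axiom `pt_frob`), `n+1 ↦ n` down the column. [folklore] -/
def frobPt : Pt p → Pt p
  | Sum.inl a => Sum.inl (a ^ p)
  | Sum.inr 0 => Sum.inr 0
  | Sum.inr (n + 1) => Sum.inr n

/-- Axiom (A1): `|η_y([x])|_{K_y} = |x|_F`. [folklore] -/
theorem absK_eta_X : ∀ (y : Pt p) (x : PadicAlgCl p), absPow p (ex p y) (ex_pos p y) (etaHom p y (X x)) = absOne p x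
  | Sum.inl a, x => by simp [etaHom, untilt, ex, norm_lift_rpow]
  | Sum.inr n, x => by
    simp only [etaHom, eval₂Hom_X', untilt, ex, absPow_apply, absOne_apply, norm_pow]
    exact Real.pow_rpow_inv_natCast (norm_nonneg x) (pow_ne_zero n hp.out.ne_zero)

/-- Axiom (A2): Teichmüller lifts of everything (a fortiori of the unit ball). [folklore] -/
theorem exists_X_lift : ∀ (y : Pt p) (ξ : PadicAlgCl p), ∃ x : PadicAlgCl p, etaHom p y (X x) = ξ
  | Sum.inl a, ξ => by simpa [etaHom, untilt] using lift_surjective p a ξ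
  | Sum.inr n, ξ => by simpa [etaHom, untilt] using IsAlgClosed.exists_pow_nat_eq ξ (pow_pos hp.out.pos n)

/-! ## 3. The model of the signature -/

/-- **The model period-ring datum** (see the module docstring for the dictionary of choices). [folklore] -/
def datum : PeriodRingDatum (PadicAlgCl p) (Ring p) (PadicAlgCl p) (Pt p) (fun _ => PadicAlgCl p) Unit where
  p := p
  p_prime := hp.out
  absF := absOne p
  norm _ := vnorm p
  norm_nonneg _ := vnorm_nonneg p
  norm_add_le _ := vnorm_add p
  teich := X
  norm_teich _ x _ _ := by rw [absOne_apply]; exact vnorm_X p x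
  gal _ := id
  frob := frobHom p
  gal_norm_one _ _ h := h
  frob_norm_one _ h := vnorm_frob_le_one p h
  absK y := absPow p (ex p y) (ex_pos p y)
  eta := etaHom p
  absK_eta_teich := absK_eta_X p
  exists_teich_lift y ξ _ := exists_X_lift p y ξ
  T _ := {0}
  zero_mem_T _ := rfl
  eta_T _ τ hτ := by rw [Set.mem_singleton_iff.1 hτ, map_zero]
  T_norm_one _ τ hτ := by rw [Set.mem_singleton_iff.1 hτ]; exact vnorm_zero_le p
  pt := Sum.inl
  frobY := frobPt p
  pt_frob _ := rfl
  galF _ := RingHom.id _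
  absF_galF _ _ := rfl
  galY _ := id
  pt_gal _ _ := rfl
  abs0 := absOne p
  abs0_p := by rw [absOne_apply]; exact norm_p_pos_lt_one p
  emb _ := RingHom.id _
  scale := ex p
  scale_pos := ex_pos p
  absK_emb _ z := by simp only [absPow_apply, absOne_apply, RingHom.id_apply]
  absK_pt a ha0 ha1 := by
    show ‖(p : PadicAlgCl p)‖ ^ expo p a = absOne p a
    rw [absOne_apply] at ha1 ⊢
    exact norm_p_rpow_expo p (norm_pos_iff.2 ha0) ha1

/-! ## 4. `hφ` and §10.13's transport hold together -/

/-- **`hφ` IN THE MODEL: `ϕ([a]) = [a^p]` for every `a ∈ F`** (p437232's second binder). [folklore] -/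
theorem frob_teich (a : PadicAlgCl p) : (datum p).frob ((datum p).teich a) = (datum p).teich (a ^ (datum p).p) := frobHom_X p a

/-- KEY IDENTITY: `η_n ∘ ϕ = η_{n+1}` as ring maps (`ev_n ∘ shift = ev_{n+1}`, `(x^p)^{p^n} = x^{p^{n+1}}`). [folklore] -/
theorem eta_comp_frob (n : ℕ) : (etaHom p (Sum.inr n)).comp (frobHom p) = etaHom p (Sum.inr (n + 1)) := by
  refine ringHom_ext (fun c => ?_) (fun x => ?_)
  · simp [etaHom, frobHom_C, idx]
  · simp [etaHom, frobHom_X, untilt, pow_succ', pow_mul]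

/-- **§10.13's `FrobeniusTransport` AT EVERY COLUMN POINT `n+1`** (p437232's first binder): `ϕ` is a ring map, `η_{n+1}` and `η_n ∘ ϕ` are onto
(constants), and `ker(η_n ∘ ϕ) = ker η_{n+1}` because the two maps are EQUAL. [folklore] -/
def transport (n : ℕ) : (datum p).FrobeniusTransport (Sum.inr (n + 1)) where
  frobHom := frobHom p
  frobHom_eq _ := rfl
  eta_surj c := ⟨C (Function.const ℤ c), by show etaHom p _ _ = c; simp [etaHom]⟩
  eta_frob_surj c := ⟨C (Function.const ℤ c), by show etaHom p (Sum.inr n) (frobHom p _) = c; simp [etaHom, frobHom_C]⟩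
  ker_eq := by
    show RingHom.ker ((etaHom p (Sum.inr n)).comp (frobHom p)) = RingHom.ker (etaHom p (Sum.inr (n + 1)))
    rw [eta_comp_frob]

/-- **NON-VACUITY of p437232's binder pair**: `T ∧ hφ` are jointly instantiated (at every column point). [folklore] -/
theorem transport_and_teichFrob_nonvacuous (n : ℕ) :
    Nonempty ((datum p).FrobeniusTransport (Sum.inr (n + 1))) ∧ ∀ a, (datum p).frob ((datum p).teich a) = (datum p).teich (a ^ (datum p).p) :=
  ⟨⟨transport p n⟩, frob_teich p⟩

/-! ## 5. What else the same structure carries: `B^{φ=p} ≠ 0`, «log hits 1», Frobenius-compatible identifications -/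

/-- The `ϕ`-eigenconstant `c_n := C(m ↦ p^{m−n})`. [folklore] -/
def eig (n : ℤ) : Ring p := C fun m : ℤ => (p : PadicAlgCl p) ^ (m - n)

/-- `c_n ∈ B^{φ=p}`: `shift(m ↦ p^{m−n}) = p · (m ↦ p^{m−n})`. [folklore] -/
theorem eig_mem_Bphi (n : ℤ) : eig p n ∈ (datum p).Bphi := by
  show frobHom p (eig p n) = ((p : ℕ) : Ring p) * eig p n
  rw [eig, frobHom_C, ← map_natCast (C : Coef p →+* Ring p) p, ← map_mul]
  congr 1
  funext m
  have hp0 : (p : PadicAlgCl p) ≠ 0 := by exact_mod_cast hp.out.ne_zero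
  simp only [shiftHom_apply, Pi.mul_apply, Pi.natCast_apply]
  rw [show m + 1 - n = m - n + 1 by ring, zpow_add_one₀ hp0, mul_comm]

/-- `c_n ≠ 0`. [folklore] -/
theorem eig_ne_zero (n : ℤ) : eig p n ≠ 0 := by
  have hp0 : (p : PadicAlgCl p) ≠ 0 := by exact_mod_cast hp.out.ne_zero
  intro h
  have h1 := congr_fun ((C_eq_zero).1 h) n
  simp only [sub_self, zpow_zero, Pi.zero_apply] at h1
  exact one_ne_zero h1

/-- **«log hits 1»** at the column point `n+1`: `η_{ϕ(n+1)}(c_n) = η_n(c_n) = p^0 = 1` — the side condition of p430819's fork theorems. [folklore] -/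
theorem hone (n : ℕ) : ∃ b ∈ (datum p).Bphi, (datum p).eta ((datum p).frobY (Sum.inr (n + 1))) b = 1 :=
  ⟨eig p n, eig_mem_Bphi p n, by show etaHom p (Sum.inr n) (eig p n) = 1; simp [etaHom, eig, idx]⟩

/-- `KummerShift` holds (trivially: `T_y = {0}`). [folklore] -/
theorem kummerShift : (datum p).KummerShift :=
  ⟨fun _ τ hτ => by
    rw [Set.mem_singleton_iff.1 hτ]; show frobHom p 0 = ((p : ℕ) : Ring p) * 0; rw [map_zero, mul_zero],
   fun _ τ hτ => by
    rw [Set.mem_singleton_iff.1 hτ]; show frobHom p 0 ∈ ({0} : Set (Ring p)); rw [map_zero]; rfl⟩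

/-- The identity identifications `K_{n+1} = K_n = Q̄_p` as a `CommonTarget` (§10.14). [folklore] -/
def idTarget (n : ℕ) : (datum p).CommonTarget (PadicAlgCl p) (Sum.inr (n + 1)) := ⟨RingEquiv.refl _, RingEquiv.refl _⟩

/-- The Frobenius residue isomorphism `σ_y` of §10.13 is the identity on elements here. [folklore] -/
theorem residueIso_apply (n : ℕ) (x : PadicAlgCl p) : (transport p n).residueIso x = x := by
  obtain ⟨b, rfl⟩ := (transport p n).eta_surj x
  rw [(transport p n).residueIso_eta]
  exact congrArg (fun f : Ring p →+* PadicAlgCl p => f b) (eta_comp_frob p n)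

/-- Hence the identity identifications are `FrobCompatible` (reading (R-ϕ) of p430819). [folklore] -/
theorem frobCompatible (n : ℕ) : PeriodRingDatum.FrobCompatible (transport p n) (idTarget p n) := fun x => residueIso_apply p n x

/-! ## 6. Consequences in the model, by the landed implications (cited BY NAME) -/

/-- p437232 in the model: `scale (ϕ y) = p · scale y` and `|σ_y ξ|_{K_{ϕ(y)}} = |ξ|^p_{K_y}` at every column point — consumed with BOTH binders
instantiated. [folklore] -/
theorem scale_frobY_and_absK_residueIso (n : ℕ) (ξ : PadicAlgCl p) :
    (datum p).scale (Sum.inr n) = p * (datum p).scale (Sum.inr (n + 1)) ∧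
      (datum p).absK (Sum.inr n) ((transport p n).residueIso ξ) = (datum p).absK (Sum.inr (n + 1)) ξ ^ p :=
  ⟨PeriodRingDatum.scale_frobY_of_transport (transport p n) (frob_teich p),
    PeriodRingDatum.absK_residueIso (transport p n) (frob_teich p) ξ⟩

/-- p430819's (R-ϕ) horn in the model, together with `hφ`: E-t3's as-printed `NoCommutingFieldIso` fails, the common-target form of
Thm. 10.15.1 (3) fails, (4) `LogShellStep` holds, and reading (R-fix) `LogsCoincide` is refuted (log hits 1, `p ≠ 1`). [folklore] -/
theorem rphi_horn (n : ℕ) :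
    ¬ (datum p).NoCommutingFieldIso (Sum.inr (n + 1)) ∧ ¬ PeriodRingDatum.NoInsertedIso (idTarget p n) ∧
      PeriodRingDatum.LogShellStep (idTarget p n) ∧ ¬ PeriodRingDatum.LogsCoincide (idTarget p n) :=
  have hp1 : ((datum p).p : PadicAlgCl p) ≠ 1 := by show (p : PadicAlgCl p) ≠ 1; exact_mod_cast hp.out.ne_one
  ⟨(datum p).not_noCommutingFieldIso_of_transport (transport p n),
    PeriodRingDatum.not_noInsertedIso_of_frobCompatible (transport p n) (idTarget p n) (frobCompatible p n),
    PeriodRingDatum.logShellStep_of_frobCompatible (transport p n) (idTarget p n) (frobCompatible p n),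
    fun h => PeriodRingDatum.logsCoincide_frobCompatible_absurd (transport p n) (idTarget p n) (frobCompatible p n) h (hone p n) hp1⟩

/-- p437232 §3 in the model: the identity identifications ARE «compatible with the valuations up to exponents» — `|x|_C = |x|^{p^{n+1}}_{K_{n+1}}`,
`|x|_C = |x|^{p^n}_{K_n}` for `|·|_C := ‖·‖` — so its binders `h₀`, `h₁` are instantiated together with `T ∧ hφ` (exponents `s₀ = p^{n+1} = p·s₁`),
and its conclusion yields an ISOMETRIC inserted automorphism here. [folklore] -/
theorem exists_isometric_insertedIso (n : ℕ) :
    ∃ τ : PadicAlgCl p ≃+* PadicAlgCl p,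
      (∀ b, τ ((idTarget p n).log₀ b) = (idTarget p n).log₁ ((datum p).frob b)) ∧ ∀ c, absOne p (τ c) = absOne p c := by
  have key : ∀ (m : ℕ) (x : PadicAlgCl p), absOne p x = (datum p).absK (Sum.inr m) x ^ ((p ^ m : ℕ) : ℝ) := fun m x => by
    rw [absOne_apply]
    show ‖x‖ = (‖x‖ ^ ((p ^ m : ℕ) : ℝ)⁻¹) ^ ((p ^ m : ℕ) : ℝ)
    rw [Real.rpow_natCast, Real.rpow_inv_natCast_pow (norm_nonneg x) (pow_ne_zero m hp.out.ne_zero)]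
  exact PeriodRingDatum.exists_isometric_insertedIso (transport p n) (frob_teich p) (idTarget p n) (absOne p)
    (fun x => key (n + 1) x) (fun x => key n x)

/-- **Packaged (over `Q̄_2`)**: ONE structure of the full period-ring signature in which `ϕ([a]) = [a^p]` for all `a`, §10.13's transport holds at
every column point, `KummerShift` holds and `B^{φ=p} ≠ 0`. [folklore] -/
theorem teichFrob_transport_nonvacuous :
    ∃ D : PeriodRingDatum (PadicAlgCl 2) (Ring 2) (PadicAlgCl 2) (Pt 2) (fun _ => PadicAlgCl 2) Unit,
      (∀ a, D.frob (D.teich a) = D.teich (a ^ D.p)) ∧ (∀ n : ℕ, Nonempty (D.FrobeniusTransport (Sum.inr (n + 1)))) ∧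
        D.KummerShift ∧ ∃ b ∈ D.Bphi, b ≠ 0 :=
  ⟨datum 2, frob_teich 2, fun n => ⟨transport 2 n⟩, kummerShift 2, eig 2 0, eig_mem_Bphi 2 0, eig_ne_zero 2 0⟩

end Summit.ABC.IUTFork.Joshi.TeichFrobModel

end
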